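import Summits.HodgeConjecture.HodgeConjecture.Theorems.F0P3cStCharTSUpTrU2Chart     -- ★ p852400 (LH7-p02 g8) (B1) «U2-CHART»: `coe_eq_diag_of_mem_torusU`, `map_entry_mul_entry_eq_one_of_mem_torusU`
import Literature.NumberTheory.Rogawski1990.FinWeylDiscriminantFactorisation          -- ★ p852353 (F0P3-p02 g23) (N1): `prod_normAbs_mul`, `prod_normAbs_eq_one_of_conjLocal_mul_self` (the `N(·) = Π_w |·|_w` currency)
import Literature.NumberTheory.Automorphic.UnitaryGroupBorelInduction                -- ★ `cmLocalForm_eq_over`, `cmBorelTriple` (the carrier's split torus `M = torusU σ (cmLocalForm L 2 v)`)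
import Mathlib.LinearAlgebra.Matrix.Charpoly.Disc
import HarnessLib

/-!
# F0 · P3c · line LH6 «StCharTS» ∕ ROAD «UP-TR» brick (H4s), sub-road «JAC-LOC₂» brick (B8a) «WEIGHT-ID-SPLIT₂»: on the split Cartan of `H_v`,
# `√(N(disc χ_t) · N(det t)⁻¹) = √N(a − 1) · √N(a⁻¹ − 1)` with `a = d·σ(d)`, `a⁻¹ = e·σ(e)` for `t = diag(d, e) ∈ U(Φ₂)(L⁺_v)`
# (Rogawski 1990 §4.9 p. 54 «`D_H`», §12.5 pp. 182–183; Harish-Chandra 1970 Lemma 22: the tube-Jacobian weight `|det(1 − Ad t)|_{𝔥∕𝔱}|`)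

Cell `pub/hodgecm-mathlib`, crux H413 = `stmt-HodgeConjecture-24833` (lane `--kind proof --supports … --as helper`, count-neutral); seat F0P3b-p01 (g20), brick (B8a) of the
sub-road «JAC-LOC₂» (sub-dealer LH7-p02 (g8), memo `F0/P3c/LH7/LH7-p02/g8/h4s/ROAD-JAC-LOC2.v1.LH7p02g8.md` §1 «`disc(χ_{m(d)})∕det = (a−1)²∕a` ⇒ `dh² = √(|disc|_w∕|det|_w)
= D₂`», dealt 2026-09-02T18:39:41Z) of ROAD «UP-TR» (holder F0P3-p02 (g23)).  THEOREMS ONLY (no definition ∕ instance ∕ notation ∕ named fact ∕ `sorry`); ★-only imports.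

THE MATHEMATICS.  For a diagonal element `t = diag(d, e)` of the quasi-split unitary group `U(σ, Φ₂)(R)` (`Φ₂ = antidiag(1,1)`; unitarity is `σ(d)·e = 1 = σ(e)·d`,
★ (B1)) one has `χ_t = (X − d)(X − e)`, `disc χ_t = (d − e)²`, `det t = d e`, and with `a := d·σ(d)` (so `a⁻¹ = e·σ(e)`, INVERSE-FREE):
  `(d − e)² = −(d e) · (a − 1) · (a⁻¹ − 1)`   (print: «`disc∕det = (a − 1)²∕a`»).
On the CM carrier `R = L ⊗ L⁺_v = Π_{w∣v} L_w`, `σ = c ⊗ 1` at a place `v` NON-SPLIT in `L`, with `N(x) = Π_w |x_w|_w` (★ (N1)): `N(d e) = N(−1) = 1` (norm-one elements),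
hence **`N(disc χ_t) · N(det t)⁻¹ = N(a − 1) · N(a⁻¹ − 1)`** and, taking square roots, the WEIGHT LETTER of the (H4s)∕(H4c) sockets (★ `WeightIdEllipticH`, LH6-p03's
socket sigsheet 9bf0eb05: `D t = NNReal.sqrt ‹the `-- eDH` radicand of ★ RUNG0 v5 at s.1 = t›`) reads **`√N(a − 1) · √N(a⁻¹ − 1)`** on the split torus — the
rank-one van Dijk modules of `n ↦ t⁻¹ n t n⁻¹` on `N̄` and `N` (`|a − 1|_F`, `|a⁻¹ − 1|_F`; `N(c) = |c|_F²` for `σ`-fixed `c`), i.e. the (B5-M) sandwich weight `D₂`.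
§3 gives the one-place reading (`v` non-split has a single `w`), the shape in which (B8) TERMINUS compares the carrier weight with the MODEL weight along
★ `localNonsplitEquiv` (the `hDD′` binder of ★ (Q9) `tubeJacobianLocal_local_of_forall_model`).

* §1 GENERIC RING (`[CommRing R]`, `σ : R →+* R`): `discr_charpoly_diag_two`, `det_diag_two`, `mul_map_mul_map_eq_one`, **`sub_sq_eq_neg_mul_of_unitary_diag`**.
* §2 CARRIER (non-split `v`): `prod_normAbs_neg`, **`prod_normAbs_discr_mul_inv_det_eq_of_coe_eq`** (any `g = diag(d,e) ∈ GL₂(R)` with `σd·e = 1 = σe·d`),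
  **`prod_normAbs_discr_mul_inv_det_eq`** (`t ∈ torusU σ (cmLocalForm L 2 v) = (cmBorelTriple L 2 v).M`), **`sqrt_dhRadicand_eq_of_mem_torusU`**,
  and the `H_v`-pair form `sqrt_dhRadicand_fst_eq_of_mem_prod` for `M_H = ((cmBorelTriple L 2 v).M).prod ⊤` (LH6-p03's `hTM` letter).
* §3 ONE PLACE: `prod_normAbs_eq_normAbs_of_subsingleton`, `sqrt_dhRadicand_eq_of_mem_torusU_onePlace`.
HONEST LABEL: count-neutral plumbing; closes no organ.  HC_CM is proved only modulo the 7 printed citations (2 remaining named inputs: hLiu418 = `stmt-HodgeConjecture-24832`,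
h413 = `stmt-HodgeConjecture-24833`) until rung 0 closes.

## References
* [Rogawski1990] J. D. Rogawski, *Automorphic Representations of Unitary Groups in Three Variables*, Ann. of Math. Stud. 123 (1990): §1.10 p. 9 (the Borel pair of `U(Φ)`),
  §4.9 p. 54 (`D_H`), §12.5 pp. 182–183 (the Weyl integration formula on `H`, Lemma 12.5.1).
* [HarishChandra1970] Harish-Chandra (notes by G. van Dijk), *Harmonic Analysis on Reductive p-adic Groups*, LNM 162 (1970), Lemma 22.
* [WeilBNT1967] A. Weil, *Basic Number Theory* (1967), Ch. I §2 (normalised absolute values of finite products).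
-/

set_option autoImplicit false
-- the mandated namespace has the single-problem summit's repeated segment (`HodgeConjecture.HodgeConjecture`)
set_option linter.dupNamespace false

noncomputable section

open NumberField IsDedekindDomain Matrix Polynomial
open scoped NNReal MatrixGroups
open Literature.NumberTheory.GaloisRepresentations Literature.NumberTheory.GaloisRepresentations.IsNonarchimedeanLocalField
open Literature.NumberTheory.Automorphic Literature.NumberTheory.Automorphic.UnitaryGroup
open Literature.NumberTheory.Rogawski1990
open Summit.HodgeConjecture.HodgeConjecture.Cruxes.H413.F0P3cStCharTSUpTrU2Chart

namespace Summit.HodgeConjecture.HodgeConjecture.Cruxes.H413.F0P3cStCharTSUpTrWeightIdSplitH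

/-! ## §1 Generic ring algebra: `disc χ_{diag(d,e)} = (d − e)² = −(de)·(a − 1)(a⁻¹ − 1)`, `a = dσd`, `a⁻¹ = eσe` -/

section Generic

variable {R : Type*} [CommRing R]

/-- `disc χ_{diag(d, e)} = (d − e)²` (Mathlib `Matrix.discr_fin_two`: `tr² − 4 det`). [cite: Rogawski1990, §4.9 p. 54] -/
theorem discr_charpoly_diag_two (d e : R) : (Matrix.charpoly !![d, 0; 0, e]).discr = (d - e) ^ 2 := by
  have h : (Matrix.charpoly !![d, 0; 0, e]).discr = Matrix.discr !![d, 0; 0, e] := rfl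
  rw [h, Matrix.discr_fin_two, Matrix.trace_fin_two, Matrix.det_fin_two]
  simp only [Matrix.of_apply, Matrix.cons_val', Matrix.cons_val_zero, Matrix.cons_val_one, Matrix.cons_val_fin_one]
  ring

/-- `det diag(d, e) = d e`. [cite: Rogawski1990, §4.9 p. 54] -/
theorem det_diag_two (d e : R) : (!![d, 0; 0, e] : Matrix (Fin 2) (Fin 2) R).det = d * e := by
  rw [Matrix.det_fin_two]
  simp

/-- `a · a′ = 1` for `a = d·σd`, `a′ = e·σe` under the unitarity relations `σd·e = 1 = σe·d` (★ (B1) `map_entry_mul_entry_eq_one_of_mem_torusU`): `a′ = a⁻¹` without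
inverses. [cite: Rogawski1990, §1.10 p. 9] -/
theorem mul_map_mul_map_eq_one (σ : R →+* R) {d e : R} (h₁ : σ d * e = 1) (h₂ : σ e * d = 1) : (d * σ d) * (e * σ e) = 1 := by
  calc (d * σ d) * (e * σ e) = (σ d * e) * (σ e * d) := by ring
    _ = 1 := by rw [h₁, h₂, one_mul]

/-- **`(d − e)² = −(d e) · ((d σd − 1) · (e σe − 1))`** under `σd·e = 1 = σe·d` — the print line «`disc(χ_{m(d)})∕det = (a − 1)²∕a`» in inverse-free form
(`(a − 1)²∕a = −(a − 1)(a⁻¹ − 1)`, `a⁻¹ = eσe`). [cite: Rogawski1990, §4.9 p. 54; §12.5 p. 182] [cite: HarishChandra1970, Lemma 22] -/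
theorem sub_sq_eq_neg_mul_of_unitary_diag (σ : R →+* R) {d e : R} (h₁ : σ d * e = 1) (h₂ : σ e * d = 1) :
    (d - e) ^ 2 = -(d * e) * ((d * σ d - 1) * (e * σ e - 1)) := by
  have key : -(d * e) * ((d * σ d - 1) * (e * σ e - 1)) = -(d * e) * ((σ d * e) * (σ e * d)) + d * (d * (σ d * e)) + e * (e * (σ e * d)) - d * e := by ring
  rw [key, h₁, h₂]
  ring

/-- The same for the characteristic polynomial and determinant of `diag(d, e)`. [cite: Rogawski1990, §4.9 p. 54] -/
theorem discr_charpoly_diag_two_eq_neg_det_mul (σ : R →+* R) {d e : R} (h₁ : σ d * e = 1) (h₂ : σ e * d = 1) :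
    (Matrix.charpoly !![d, 0; 0, e]).discr = -(!![d, 0; 0, e] : Matrix (Fin 2) (Fin 2) R).det * ((d * σ d - 1) * (e * σ e - 1)) := by
  rw [discr_charpoly_diag_two, det_diag_two, sub_sq_eq_neg_mul_of_unitary_diag σ h₁ h₂]

end Generic

/-! ## §2 The CM carrier at a non-split place: `N(disc χ_t) · N(det t)⁻¹ = N(a − 1) · N(a⁻¹ − 1)` on the split torus -/

section Carrier

variable (L : Type) [Field L] [NumberField L] [IsCMField L] (v : HeightOneSpectrum (𝓞 ↥(maximalRealSubfield L)))

omit [IsCMField L] in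
/-- `N(−x) = N(x)`. [cite: WeilBNT1967, Ch. I §2] -/
theorem prod_normAbs_neg (x : UnitaryGroup.LocalRing L v) :
    ∏ w : PlacesOver L v, normAbs (w.1.adicCompletion L) ((-x) w) = ∏ w : PlacesOver L v, normAbs (w.1.adicCompletion L) (x w) :=
  Finset.prod_congr rfl fun w _ => by rw [Pi.neg_apply, normAbs_neg]

/-- **`N(disc χ_g) · N(det g)⁻¹ = N(d σd − 1) · N(e σe − 1)`** for `g = diag(d, e) ∈ GL₂(R)` with the unitarity relations `σd·e = 1 = σe·d` (`R = L ⊗ L⁺_v`, `σ = c ⊗ 1`,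
`N(x) = Π_w |x_w|_w`) at a place `v` NON-SPLIT in `L` (`N(de) = 1`: `σ(de)·(de) = (σd·e)(σe·d) = 1`, ★ (N1) `prod_normAbs_eq_one_of_conjLocal_mul_self`; `N(−x) = N(x)`).
Shape-level head: any `g` with a prescribed diagonal matrix (the (B1) letters' style). [cite: Rogawski1990, §4.9 p. 54; §12.5 pp. 182–183] [cite: HarishChandra1970, Lemma 22] -/
theorem prod_normAbs_discr_mul_inv_det_eq_of_coe_eq (hns : ∀ w : PlacesOver L v, IsCMField.complexConj L • w.1 = w.1)
    (g : GL (Fin 2) (UnitaryGroup.LocalRing L v)) {d e : UnitaryGroup.LocalRing L v} (hg : g.val = !![d, 0; 0, e])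
    (h₁ : conjLocal L (IsCMField.complexConj L) v d * e = 1) (h₂ : conjLocal L (IsCMField.complexConj L) v e * d = 1) :
    (∏ w : PlacesOver L v, normAbs (w.1.adicCompletion L) ((g.val.charpoly.discr) w)) *
      (∏ w : PlacesOver L v, normAbs (w.1.adicCompletion L) ((g.val.det) w))⁻¹ =
    (∏ w : PlacesOver L v, normAbs (w.1.adicCompletion L) ((d * conjLocal L (IsCMField.complexConj L) v d - 1) w)) *
      ∏ w : PlacesOver L v, normAbs (w.1.adicCompletion L) ((e * conjLocal L (IsCMField.complexConj L) v e - 1) w) := by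
  have hde : conjLocal L (IsCMField.complexConj L) v (d * e) * (d * e) = 1 := by
    calc conjLocal L (IsCMField.complexConj L) v (d * e) * (d * e)
        = (conjLocal L (IsCMField.complexConj L) v d * e) * (conjLocal L (IsCMField.complexConj L) v e * d) := by rw [map_mul]; ring
      _ = 1 := by rw [h₁, h₂, one_mul]
  have hNde : ∏ w : PlacesOver L v, normAbs (w.1.adicCompletion L) ((d * e) w) = 1 := prod_normAbs_eq_one_of_conjLocal_mul_self L v hns hde
  rw [hg, discr_charpoly_diag_two_eq_neg_det_mul (conjLocal L (IsCMField.complexConj L) v) h₁ h₂, det_diag_two, neg_mul, prod_normAbs_neg,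
    prod_normAbs_mul L v (d * e), hNde, one_mul, inv_one, mul_one, prod_normAbs_mul]

/-- **`N(disc χ_t) · N(det t)⁻¹ = N(a − 1) · N(a⁻¹ − 1)` ON THE SPLIT TORUS** `M = torusU σ (cmLocalForm L 2 v) = (cmBorelTriple L 2 v).M` of `U(Φ₂)(L⁺_v)` (`v` non-split):
`a = t₀₀·σ(t₀₀)`, `a⁻¹ = t₁₁·σ(t₁₁)` (★ (B1): `↑↑t = diag(t₀₀, t₁₁)`, `σ t₀₀ · t₁₁ = 1 = σ t₁₁ · t₀₀`, as `cmLocalForm L 2 v = Φ₂` ★ `cmLocalForm_eq_over`).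
[cite: Rogawski1990, §1.10 p. 9; §4.9 p. 54; §12.5 pp. 182–183] [cite: HarishChandra1970, Lemma 22] -/
theorem prod_normAbs_discr_mul_inv_det_eq (hns : ∀ w : PlacesOver L v, IsCMField.complexConj L • w.1 = w.1)
    {t : ↥(unitaryGroupOfForm (conjLocal L (IsCMField.complexConj L) v) (cmLocalForm L 2 v))}
    (ht : t ∈ torusU (conjLocal L (IsCMField.complexConj L) v) (cmLocalForm L 2 v)) :
    (∏ w : PlacesOver L v, normAbs (w.1.adicCompletion L) (((t : GL (Fin 2) (UnitaryGroup.LocalRing L v)).val.charpoly.discr) w)) *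
      (∏ w : PlacesOver L v, normAbs (w.1.adicCompletion L) (((t : GL (Fin 2) (UnitaryGroup.LocalRing L v)).val.det) w))⁻¹ =
    (∏ w : PlacesOver L v, normAbs (w.1.adicCompletion L)
        (((t : GL (Fin 2) (UnitaryGroup.LocalRing L v)).val 0 0 *
            conjLocal L (IsCMField.complexConj L) v ((t : GL (Fin 2) (UnitaryGroup.LocalRing L v)).val 0 0) - 1) w)) *
      ∏ w : PlacesOver L v, normAbs (w.1.adicCompletion L)
        (((t : GL (Fin 2) (UnitaryGroup.LocalRing L v)).val 1 1 *
            conjLocal L (IsCMField.complexConj L) v ((t : GL (Fin 2) (UnitaryGroup.LocalRing L v)).val 1 1) - 1) w) := by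
  obtain ⟨h₁, h₂⟩ := map_entry_mul_entry_eq_one_of_mem_torusU (conjLocal L (IsCMField.complexConj L) v) (cmLocalForm_eq_over L 2 v) ht
  exact prod_normAbs_discr_mul_inv_det_eq_of_coe_eq L v hns (t : GL (Fin 2) (UnitaryGroup.LocalRing L v))
    (coe_eq_diag_of_mem_torusU (conjLocal L (IsCMField.complexConj L) v) ht) h₁ h₂

/-- **THE WEIGHT LETTER ON THE SPLIT TORUS: `√(N(disc χ_t) · N(det t)⁻¹) = √N(d σd − 1) · √N(e σe − 1)`** — the left side is, token for token at `s.1 = t`, the weight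
`D` of ROAD «UP-TR»'s (H4s) socket (`NNReal.sqrt` of the `-- eDH` radicand; ★ `WeightIdEllipticH.DH_sq_eq_sqrt`); the right side is the product of the two rank-one van Dijk
modules (`|a − 1|_F · |a⁻¹ − 1|_F`, `a = dσd`, squared norms `N(c) = |c|_F²` for `σ`-fixed `c`). [cite: Rogawski1990, §12.5 pp. 182–183] [cite: HarishChandra1970, Lemma 22] -/
theorem sqrt_dhRadicand_eq_of_mem_torusU (hns : ∀ w : PlacesOver L v, IsCMField.complexConj L • w.1 = w.1)
    {t : ↥(unitaryGroupOfForm (conjLocal L (IsCMField.complexConj L) v) (cmLocalForm L 2 v))}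
    (ht : t ∈ torusU (conjLocal L (IsCMField.complexConj L) v) (cmLocalForm L 2 v)) :
    NNReal.sqrt
        ((∏ w : PlacesOver L v, normAbs (w.1.adicCompletion L) (((t : GL (Fin 2) (UnitaryGroup.LocalRing L v)).val.charpoly.discr) w)) *
          (∏ w : PlacesOver L v, normAbs (w.1.adicCompletion L) (((t : GL (Fin 2) (UnitaryGroup.LocalRing L v)).val.det) w))⁻¹) =
      NNReal.sqrt (∏ w : PlacesOver L v, normAbs (w.1.adicCompletion L)
          (((t : GL (Fin 2) (UnitaryGroup.LocalRing L v)).val 0 0 *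
              conjLocal L (IsCMField.complexConj L) v ((t : GL (Fin 2) (UnitaryGroup.LocalRing L v)).val 0 0) - 1) w)) *
        NNReal.sqrt (∏ w : PlacesOver L v, normAbs (w.1.adicCompletion L)
          (((t : GL (Fin 2) (UnitaryGroup.LocalRing L v)).val 1 1 *
              conjLocal L (IsCMField.complexConj L) v ((t : GL (Fin 2) (UnitaryGroup.LocalRing L v)).val 1 1) - 1) w)) := by
  rw [prod_normAbs_discr_mul_inv_det_eq L v hns ht, NNReal.sqrt_mul]

/-- **`H_v`-pair form on `M_H = M × U(Φ₁)`** (LH6-p03's socket letter `hTM : T = ((cmBorelTriple L 2 v).M).prod ⊤`): for `s ∈ M_H`, the weight letter at `s.1` is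
`√N(a − 1) · √N(a⁻¹ − 1)` with `a = s.1₀₀ · σ(s.1₀₀)`, `a⁻¹ = s.1₁₁ · σ(s.1₁₁)`. [cite: Rogawski1990, §12.5 pp. 182–183] -/
theorem sqrt_dhRadicand_fst_eq_of_mem_prod (hns : ∀ w : PlacesOver L v, IsCMField.complexConj L • w.1 = w.1)
    {T : Subgroup (((UnitaryGroup.cmDatum L 2 (Matrix.of fun i j : Fin 2 => if i.val + j.val + 1 = 2 then (1 : L) else 0)).Local v ×
      (UnitaryGroup.cmDatum L 1 (Matrix.of fun i j : Fin 1 => if i.val + j.val + 1 = 1 then (1 : L) else 0)).Local v))}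
    (hTM : T = ((cmBorelTriple L 2 v).M).prod ⊤)
    {s : ((UnitaryGroup.cmDatum L 2 (Matrix.of fun i j : Fin 2 => if i.val + j.val + 1 = 2 then (1 : L) else 0)).Local v ×
      (UnitaryGroup.cmDatum L 1 (Matrix.of fun i j : Fin 1 => if i.val + j.val + 1 = 1 then (1 : L) else 0)).Local v)} (hs : s ∈ T) :
    NNReal.sqrt
        ((∏ w : PlacesOver L v, normAbs (w.1.adicCompletion L) (((s.1.val : GL (Fin 2) (UnitaryGroup.LocalRing L v)).val.charpoly.discr) w)) *
          (∏ w : PlacesOver L v, normAbs (w.1.adicCompletion L) (((s.1.val : GL (Fin 2) (UnitaryGroup.LocalRing L v)).val.det) w))⁻¹) =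
      NNReal.sqrt (∏ w : PlacesOver L v, normAbs (w.1.adicCompletion L)
          (((s.1.val : GL (Fin 2) (UnitaryGroup.LocalRing L v)).val 0 0 * conjLocal L (IsCMField.complexConj L) v ((s.1.val : GL (Fin 2) (UnitaryGroup.LocalRing L v)).val 0 0) - 1) w)) *
        NNReal.sqrt (∏ w : PlacesOver L v, normAbs (w.1.adicCompletion L)
          (((s.1.val : GL (Fin 2) (UnitaryGroup.LocalRing L v)).val 1 1 * conjLocal L (IsCMField.complexConj L) v ((s.1.val : GL (Fin 2) (UnitaryGroup.LocalRing L v)).val 1 1) - 1) w)) := by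
  subst hTM
  have h1 : s.1 ∈ (cmBorelTriple L 2 v).M := (Subgroup.mem_prod.1 hs).1
  exact sqrt_dhRadicand_eq_of_mem_torusU L v hns h1

end Carrier

/-! ## §3 One-place reading (a non-split `v` has a single place `w` above it) -/

section OnePlace

variable (L : Type) [Field L] [NumberField L] [IsCMField L] (v : HeightOneSpectrum (𝓞 ↥(maximalRealSubfield L)))

omit [IsCMField L] in
/-- With a single place `w ∣ v` (`Subsingleton (PlacesOver L v)`, the non-split case), `N(x) = |x_w|_w`. [cite: WeilBNT1967, Ch. I §2] -/
theorem prod_normAbs_eq_normAbs_of_subsingleton (hv : Subsingleton (PlacesOver L v)) (w : PlacesOver L v) (x : UnitaryGroup.LocalRing L v) :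
    ∏ w' : PlacesOver L v, normAbs (w'.1.adicCompletion L) (x w') = normAbs (w.1.adicCompletion L) (x w) := by
  have huniv : (Finset.univ : Finset (PlacesOver L v)) = {w} := by
    ext w'
    simp only [Finset.mem_univ, Finset.mem_singleton, true_iff]
    exact Subsingleton.elim w' w
  rw [huniv, Finset.prod_singleton]

/-- **One-place form of the weight letter on the split torus**: with the single `w ∣ v`, `√(|disc χ_t|_w · |det t|_w⁻¹) = √|dσd − 1|_w · √|eσe − 1|_w` (all at the `w`-components) —
the shape compared with the MODEL weight of sub-road «JAC-LOC₂» along ★ `localNonsplitEquiv` in (B8)'s `hDD′`. [cite: Rogawski1990, §12.5 pp. 182–183] [cite: HarishChandra1970, Lemma 22] -/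
theorem sqrt_dhRadicand_eq_of_mem_torusU_onePlace (hns : ∀ w : PlacesOver L v, IsCMField.complexConj L • w.1 = w.1)
    (hv : Subsingleton (PlacesOver L v)) (w : PlacesOver L v)
    {t : ↥(unitaryGroupOfForm (conjLocal L (IsCMField.complexConj L) v) (cmLocalForm L 2 v))}
    (ht : t ∈ torusU (conjLocal L (IsCMField.complexConj L) v) (cmLocalForm L 2 v)) :
    NNReal.sqrt
        ((∏ w' : PlacesOver L v, normAbs (w'.1.adicCompletion L) (((t : GL (Fin 2) (UnitaryGroup.LocalRing L v)).val.charpoly.discr) w')) *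
          (∏ w' : PlacesOver L v, normAbs (w'.1.adicCompletion L) (((t : GL (Fin 2) (UnitaryGroup.LocalRing L v)).val.det) w'))⁻¹) =
      NNReal.sqrt (normAbs (w.1.adicCompletion L)
          (((t : GL (Fin 2) (UnitaryGroup.LocalRing L v)).val 0 0 *
              conjLocal L (IsCMField.complexConj L) v ((t : GL (Fin 2) (UnitaryGroup.LocalRing L v)).val 0 0) - 1) w)) *
        NNReal.sqrt (normAbs (w.1.adicCompletion L)
          (((t : GL (Fin 2) (UnitaryGroup.LocalRing L v)).val 1 1 *
              conjLocal L (IsCMField.complexConj L) v ((t : GL (Fin 2) (UnitaryGroup.LocalRing L v)).val 1 1) - 1) w)) := by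
  rw [sqrt_dhRadicand_eq_of_mem_torusU L v hns ht, prod_normAbs_eq_normAbs_of_subsingleton L v hv w,
    prod_normAbs_eq_normAbs_of_subsingleton L v hv w]

end OnePlace

/-! ## §4 (ED. 2) The one-place weight in the MODEL's shape `√(|a − 1|_w · |a⁻¹ − 1|_w)`, `a = t₀₀,w · σ_w(t₀₀,w)` — the (B7b)∕(B8-D) dictionary

ED. 2 (2026-09-02, same seat; append-only, §1–§3 byte-identical): sub-road «JAC-LOC₂»'s MODEL weight is `D₂ t = NNReal.sqrt (‖a − 1‖ · ‖a⁻¹ − 1‖)` with the FIELD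
inverse (★-to-be (B7b) `…UpTrU2Horbit.weightTwo_eq_of_valuation_eq`'s letter); §2's carrier head is inverse-free (`a⁻¹ = eσe`).  At the single place `w` of a non-split `v`
the two agree: `(eσe)_w = ((dσd)_w)⁻¹` in the field `L_w`, `(x · σ x)_w = x_w · σ_w(x_w)` with `σ_w = galAdicCompletionMap c` (★ `conjLocal_apply_eq_galAdicCompletionMap`), so the
carrier weight letter equals `√(|a_w − 1|_w · |a_w⁻¹ − 1|_w)`, `a_w := t₀₀,w · σ_w(t₀₀,w)` — the `hDD′` comparison of ★ (Q9) `tubeJacobianLocal_local_of_forall_model` up to ★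
`weightFormula_eq_normAbs_model_two`'s identification of the model matrix with the `w`-component. -/

section ModelShape

variable (L : Type) [Field L] [NumberField L] [IsCMField L] (v : HeightOneSpectrum (𝓞 ↥(maximalRealSubfield L)))

/-- `(x · σ x)_w = x_w · σ_w(x_w)` at a `c`-fixed place `w` (`σ = c ⊗ 1`, `σ_w = galAdicCompletionMap c`; ★ `conjLocal_apply_eq_galAdicCompletionMap`).
[cite: Rogawski1990, §4.9 p. 54] -/
theorem mul_conjLocal_apply_eq (w : PlacesOver L v) (hw : IsCMField.complexConj L • w.1 = w.1) (x : UnitaryGroup.LocalRing L v) :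
    (x * conjLocal L (IsCMField.complexConj L) v x) w = x w * galAdicCompletionMap (L := L) (IsCMField.complexConj L) hw (x w) := by
  rw [Pi.mul_apply, conjLocal_apply_eq_galAdicCompletionMap L v w hw x]

/-- `(e · σ e)_w = ((d · σ d)_w)⁻¹` in the field `L_w` under the unitarity relations `σd·e = 1 = σe·d` (§1 `mul_map_mul_map_eq_one` read at `w`).
[cite: Rogawski1990, §1.10 p. 9] -/
theorem mul_map_apply_eq_inv (w : PlacesOver L v) {d e : UnitaryGroup.LocalRing L v}
    (h₁ : conjLocal L (IsCMField.complexConj L) v d * e = 1) (h₂ : conjLocal L (IsCMField.complexConj L) v e * d = 1) :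
    (e * conjLocal L (IsCMField.complexConj L) v e) w = ((d * conjLocal L (IsCMField.complexConj L) v d) w)⁻¹ := by
  have h := congrArg (fun y : UnitaryGroup.LocalRing L v => y w) (mul_map_mul_map_eq_one (conjLocal L (IsCMField.complexConj L) v) h₁ h₂)
  simp only [Pi.mul_apply, Pi.one_apply] at h
  rw [Pi.mul_apply, Pi.mul_apply]
  exact (eq_inv_of_mul_eq_one_right h)

/-- **ONE-PLACE WEIGHT IN THE MODEL's SHAPE**: for `t` in the split torus of `U(Φ₂)(L⁺_v)` at a non-split `v` with its single place `w`,
`√(N(disc χ_t) · N(det t)⁻¹) = √( |a − 1|_w · |a⁻¹ − 1|_w )`, `a := t₀₀,w · σ_w(t₀₀,w) ∈ L_w` (FIELD inverse) — token shape of sub-road «JAC-LOC₂»'s model weight `D₂`.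
[cite: Rogawski1990, §12.5 pp. 182–183] [cite: HarishChandra1970, Lemma 22] -/
theorem sqrt_dhRadicand_eq_sqrt_normAbs_mul_inv_onePlace (hns : ∀ w : PlacesOver L v, IsCMField.complexConj L • w.1 = w.1)
    (hv : Subsingleton (PlacesOver L v)) (w : PlacesOver L v)
    {t : ↥(unitaryGroupOfForm (conjLocal L (IsCMField.complexConj L) v) (cmLocalForm L 2 v))}
    (ht : t ∈ torusU (conjLocal L (IsCMField.complexConj L) v) (cmLocalForm L 2 v)) :
    NNReal.sqrt
        ((∏ w' : PlacesOver L v, normAbs (w'.1.adicCompletion L) ((((t : GL (Fin 2) (UnitaryGroup.LocalRing L v)).val).charpoly.discr) w')) *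
          (∏ w' : PlacesOver L v, normAbs (w'.1.adicCompletion L) ((((t : GL (Fin 2) (UnitaryGroup.LocalRing L v)).val).det) w'))⁻¹) =
      NNReal.sqrt
        (normAbs (w.1.adicCompletion L)
            (((t : GL (Fin 2) (UnitaryGroup.LocalRing L v)).val 0 0) w *
                galAdicCompletionMap (L := L) (IsCMField.complexConj L) (hns w) (((t : GL (Fin 2) (UnitaryGroup.LocalRing L v)).val 0 0) w) - 1) *
          normAbs (w.1.adicCompletion L)
            ((((t : GL (Fin 2) (UnitaryGroup.LocalRing L v)).val 0 0) w *
                galAdicCompletionMap (L := L) (IsCMField.complexConj L) (hns w) (((t : GL (Fin 2) (UnitaryGroup.LocalRing L v)).val 0 0) w))⁻¹ - 1)) := by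
  obtain ⟨h₁, h₂⟩ := map_entry_mul_entry_eq_one_of_mem_torusU (conjLocal L (IsCMField.complexConj L) v) (cmLocalForm_eq_over L 2 v) ht
  rw [sqrt_dhRadicand_eq_of_mem_torusU_onePlace L v hns hv w ht, ← NNReal.sqrt_mul, Pi.sub_apply, Pi.sub_apply, Pi.one_apply,
    mul_map_apply_eq_inv L v w h₁ h₂, mul_conjLocal_apply_eq L v w (hns w)]

end ModelShape

end Summit.HodgeConjecture.HodgeConjecture.Cruxes.H413.F0P3cStCharTSUpTrWeightIdSplitH

end
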